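import Summits.ValiantsHypothesis.ValiantsHypothesis.Theorems.RigidityForcesSymmetryRankRigidMinimalReprLaplaceResidualTransport
import Summits.ValiantsHypothesis.ValiantsHypothesis.Theorems.RigidityForcesSymmetryRankRigidMinimalReprLaplaceResidualCase1
import Summits.ValiantsHypothesis.ValiantsHypothesis.Theorems.RigidityForcesSymmetryRankRigidMinimalReprLaplaceFiveAtMostTwoSlices

/-!
# The `a = 3` residual of `LaplaceOptimal 5`: ASSEMBLY of the hypothesis `hres` from two configurations, and
# «a cheap decomposition of `P₅` has at most two slices» conditional on the two CASE-2 theorems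
# (crux `RankRigidMinimalRepr`, stmt-18034; frontier rung `LaplaceOptimalFive`, stmt-24813)

Lead file of the three-hand cut (val-lit desk g12 RULING #263 (c): val-port-2 = assembly, val-lit-p8 g11 = Case 1,
val-lit-p3 g14 = Case 2) on the four residual configurations of `LaplaceFiveSlices.laplace_five_three_slices_residual`
(`(c; p0 q0, p1 q1, p2 q2) ∈ {(0; 01,02,12), (0; 01,02,34), (0; 01,12,34), (0; 02,12,34)}`).

* **`residual_of_configs`** — the hypothesis `hres` of `LaplaceFiveSlices.laplace_five_at_most_two_slices_of_residual`,
  VERBATIM, follows from the two configuration statements for the TRIANGLE `(0; 01,02,12)` and for `(0; 01,02,34)`: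
  the list membership is split, the slot-`0` component `![![0,1,2],…] 0` is the literal `![0,1,2]`, and the two other
  labellings are the slot transports `config_swap01` / `config_swap02` (`…LaplaceResidualTransport`).
* **`residual_of_case2`** — with val-lit-p8 g11's landed CASE-1 theorems `triangle_case1` / `outside_case1`
  (`…LaplaceResidualCase1`, hypothesis `hfull`: a full-support covector orthogonal to the slot-`0` slice vector) plugged
  into `config_of_cases`, `hres` follows from the two CASE-2 statements ALONE — the triangle and `(0; 01,02,34)` under
  `hind : ∃ a, α 0 a ≠ 0 ∧ ∀ c, c ≠ a → α 0 c = 0` (the slot-`0` slice vector is a letter indicator) — which are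
  val-lit-p3 g14's deliverables (`triangle_case2`, `outside_case2`, signatures = p8's with `hfull ↦ hind`).
* **`laplace_five_at_most_two_slices_of_case2`** — hence, conditionally on those two statements, in the official data
  format of `LaplaceOptimal 5` a decomposition of total Laplace weight `< 120` has AT MOST TWO slice terms.  When the two
  Case-2 theorems land, the unconditional theorem is one `exact`.
No definitions.  HONEST FRAMING: `hres` is discharged here only CONDITIONALLY on the two Case-2 statements; the frontier
rung `LaplaceOptimalFive` (stmt-24813: no cheap decomposition at all), 24814 and the crux 18034 stay OPEN; nothing here
bears on `VP ≠ VNP`. [folklore]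
-/

set_option autoImplicit false

-- the mandated summit-side namespace repeats a component by design (single-problem summit)
set_option linter.dupNamespace false

namespace Summit.ValiantsHypothesis.ValiantsHypothesis.Theorems.RigidityForcesSymmetryRankRigidMinimalRepr

namespace LaplaceResidual

open Finset

/-- **`hres` from two configurations.**  The residual hypothesis of `laplace_five_at_most_two_slices_of_residual`
follows from the configuration statements for the triangle `(0; 01,02,12)` and for `(0; 01,02,34)`. [folklore] -/
theorem residual_of_configs
    (hT : ∀ (α : Fin 3 → Fin 5 → ℂ) (W : Fin 3 → (Fin 5 → Fin 5) → ℂ),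
      (∀ k, ∀ v v' : Fin 5 → Fin 5, (∀ j, j ≠ (![0, 1, 2] : Fin 3 → Fin 5) k → v j = v' j) → W k v = W k v') →
      ∀ (u w : Fin 3 → (Fin 5 → Fin 5) → ℂ),
      (∀ t, ∀ v v' : Fin 5 → Fin 5, v ((![0, 0, 1] : Fin 3 → Fin 5) t) = v' ((![0, 0, 1] : Fin 3 → Fin 5) t) →
        v ((![1, 2, 2] : Fin 3 → Fin 5) t) = v' ((![1, 2, 2] : Fin 3 → Fin 5) t) → u t v = u t v') →
      (∀ t, ∀ v v' : Fin 5 → Fin 5, (∀ j, j ≠ (![0, 0, 1] : Fin 3 → Fin 5) t →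
        j ≠ (![1, 2, 2] : Fin 3 → Fin 5) t → v j = v' j) → w t v = w t v') →
      ¬ ∀ v : Fin 5 → Fin 5, (if Function.Injective v then (1 : ℂ) else 0) =
        (∑ k, α k (v ((![0, 1, 2] : Fin 3 → Fin 5) k)) * W k v) + ∑ t, u t v * w t v)
    (hO0 : ∀ (α : Fin 3 → Fin 5 → ℂ) (W : Fin 3 → (Fin 5 → Fin 5) → ℂ),
      (∀ k, ∀ v v' : Fin 5 → Fin 5, (∀ j, j ≠ (![0, 1, 2] : Fin 3 → Fin 5) k → v j = v' j) → W k v = W k v') →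
      ∀ (u w : Fin 3 → (Fin 5 → Fin 5) → ℂ),
      (∀ t, ∀ v v' : Fin 5 → Fin 5, v ((![0, 0, 3] : Fin 3 → Fin 5) t) = v' ((![0, 0, 3] : Fin 3 → Fin 5) t) →
        v ((![1, 2, 4] : Fin 3 → Fin 5) t) = v' ((![1, 2, 4] : Fin 3 → Fin 5) t) → u t v = u t v') →
      (∀ t, ∀ v v' : Fin 5 → Fin 5, (∀ j, j ≠ (![0, 0, 3] : Fin 3 → Fin 5) t →
        j ≠ (![1, 2, 4] : Fin 3 → Fin 5) t → v j = v' j) → w t v = w t v') →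
      ¬ ∀ v : Fin 5 → Fin 5, (if Function.Injective v then (1 : ℂ) else 0) =
        (∑ k, α k (v ((![0, 1, 2] : Fin 3 → Fin 5) k)) * W k v) + ∑ t, u t v * w t v) :
    ∀ (c : Fin 3) (p0 q0 p1 q1 p2 q2 : Fin 5),
      (c, p0, q0, p1, q1, p2, q2) ∈ ([(0, 0, 1, 0, 2, 1, 2), (0, 0, 1, 0, 2, 3, 4), (0, 0, 1, 1, 2, 3, 4), (0, 0, 2, 1, 2, 3, 4)] : List (Fin 3 × Fin 5 × Fin 5 × Fin 5 × Fin 5 × Fin 5 × Fin 5)) →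
      ∀ (α : Fin 3 → Fin 5 → ℂ) (W : Fin 3 → (Fin 5 → Fin 5) → ℂ),
        (∀ k, ∀ v v' : Fin 5 → Fin 5, (∀ j, j ≠ (![![0, 1, 2], ![0, 0, 1], ![0, 0, 0]] : Fin 3 → Fin 3 → Fin 5) c k → v j = v' j) → W k v = W k v') →
        ∀ (u' w' : Fin 3 → (Fin 5 → Fin 5) → ℂ),
          (∀ t, ∀ v v' : Fin 5 → Fin 5, v ((![p0, p1, p2] : Fin 3 → Fin 5) t) = v' ((![p0, p1, p2] : Fin 3 → Fin 5) t) →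
            v ((![q0, q1, q2] : Fin 3 → Fin 5) t) = v' ((![q0, q1, q2] : Fin 3 → Fin 5) t) → u' t v = u' t v') →
          (∀ t, ∀ v v' : Fin 5 → Fin 5, (∀ j, j ≠ (![p0, p1, p2] : Fin 3 → Fin 5) t →
            j ≠ (![q0, q1, q2] : Fin 3 → Fin 5) t → v j = v' j) → w' t v = w' t v') →
          ¬ ∀ v : Fin 5 → Fin 5, (if Function.Injective v then (1 : ℂ) else 0) =
            (∑ k, α k (v ((![![0, 1, 2], ![0, 0, 1], ![0, 0, 0]] : Fin 3 → Fin 3 → Fin 5) c k)) * W k v) + ∑ t, u' t v * w' t v := by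
  intro c p0 q0 p1 q1 p2 q2 hmem α W hW u' w' hu' hw'
  simp only [List.mem_cons, Prod.mk.injEq, List.mem_nil_iff, or_false] at hmem
  rcases hmem with ⟨rfl, rfl, rfl, rfl, rfl, rfl, rfl⟩ | ⟨rfl, rfl, rfl, rfl, rfl, rfl, rfl⟩ |
      ⟨rfl, rfl, rfl, rfl, rfl, rfl, rfl⟩ | ⟨rfl, rfl, rfl, rfl, rfl, rfl, rfl⟩
  · simp only [Matrix.cons_val_zero] at hW ⊢
    exact hT α W hW u' w' hu' hw'
  · simp only [Matrix.cons_val_zero] at hW ⊢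
    exact hO0 α W hW u' w' hu' hw'
  · simp only [Matrix.cons_val_zero] at hW ⊢
    exact config_swap01 hO0 α W hW u' w' hu' hw'
  · simp only [Matrix.cons_val_zero] at hW ⊢
    exact config_swap02 hO0 α W hW u' w' hu' hw'

/-- **`hres` from the two CASE-2 statements.**  With val-lit-p8 g11's Case-1 theorems `triangle_case1` / `outside_case1`
(a full-support covector orthogonal to the slot-`0` slice vector), the residual hypothesis follows from the Case-2
statements for the triangle and for `(0; 01,02,34)` (slot-`0` slice vector a letter indicator) alone. [folklore] -/
theorem residual_of_case2
    (case2_T : ∀ (α : Fin 3 → Fin 5 → ℂ) (W : Fin 3 → (Fin 5 → Fin 5) → ℂ),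
      (∀ k, ∀ v v' : Fin 5 → Fin 5, (∀ j, j ≠ (![0, 1, 2] : Fin 3 → Fin 5) k → v j = v' j) → W k v = W k v') →
      ∀ (u w : Fin 3 → (Fin 5 → Fin 5) → ℂ),
      (∀ t, ∀ v v' : Fin 5 → Fin 5, v ((![0, 0, 1] : Fin 3 → Fin 5) t) = v' ((![0, 0, 1] : Fin 3 → Fin 5) t) →
        v ((![1, 2, 2] : Fin 3 → Fin 5) t) = v' ((![1, 2, 2] : Fin 3 → Fin 5) t) → u t v = u t v') →
      (∀ t, ∀ v v' : Fin 5 → Fin 5, (∀ j, j ≠ (![0, 0, 1] : Fin 3 → Fin 5) t →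
        j ≠ (![1, 2, 2] : Fin 3 → Fin 5) t → v j = v' j) → w t v = w t v') →
      (∃ a, α 0 a ≠ 0 ∧ ∀ c, c ≠ a → α 0 c = 0) →
      ¬ ∀ v : Fin 5 → Fin 5, (if Function.Injective v then (1 : ℂ) else 0) =
        (∑ k, α k (v ((![0, 1, 2] : Fin 3 → Fin 5) k)) * W k v) + ∑ t, u t v * w t v)
    (case2_O0 : ∀ (α : Fin 3 → Fin 5 → ℂ) (W : Fin 3 → (Fin 5 → Fin 5) → ℂ),
      (∀ k, ∀ v v' : Fin 5 → Fin 5, (∀ j, j ≠ (![0, 1, 2] : Fin 3 → Fin 5) k → v j = v' j) → W k v = W k v') →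
      ∀ (u w : Fin 3 → (Fin 5 → Fin 5) → ℂ),
      (∀ t, ∀ v v' : Fin 5 → Fin 5, v ((![0, 0, 3] : Fin 3 → Fin 5) t) = v' ((![0, 0, 3] : Fin 3 → Fin 5) t) →
        v ((![1, 2, 4] : Fin 3 → Fin 5) t) = v' ((![1, 2, 4] : Fin 3 → Fin 5) t) → u t v = u t v') →
      (∀ t, ∀ v v' : Fin 5 → Fin 5, (∀ j, j ≠ (![0, 0, 3] : Fin 3 → Fin 5) t →
        j ≠ (![1, 2, 4] : Fin 3 → Fin 5) t → v j = v' j) → w t v = w t v') →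
      (∃ a, α 0 a ≠ 0 ∧ ∀ c, c ≠ a → α 0 c = 0) →
      ¬ ∀ v : Fin 5 → Fin 5, (if Function.Injective v then (1 : ℂ) else 0) =
        (∑ k, α k (v ((![0, 1, 2] : Fin 3 → Fin 5) k)) * W k v) + ∑ t, u t v * w t v) :
    ∀ (c : Fin 3) (p0 q0 p1 q1 p2 q2 : Fin 5),
      (c, p0, q0, p1, q1, p2, q2) ∈ ([(0, 0, 1, 0, 2, 1, 2), (0, 0, 1, 0, 2, 3, 4), (0, 0, 1, 1, 2, 3, 4), (0, 0, 2, 1, 2, 3, 4)] : List (Fin 3 × Fin 5 × Fin 5 × Fin 5 × Fin 5 × Fin 5 × Fin 5)) →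
      ∀ (α : Fin 3 → Fin 5 → ℂ) (W : Fin 3 → (Fin 5 → Fin 5) → ℂ),
        (∀ k, ∀ v v' : Fin 5 → Fin 5, (∀ j, j ≠ (![![0, 1, 2], ![0, 0, 1], ![0, 0, 0]] : Fin 3 → Fin 3 → Fin 5) c k → v j = v' j) → W k v = W k v') →
        ∀ (u' w' : Fin 3 → (Fin 5 → Fin 5) → ℂ),
          (∀ t, ∀ v v' : Fin 5 → Fin 5, v ((![p0, p1, p2] : Fin 3 → Fin 5) t) = v' ((![p0, p1, p2] : Fin 3 → Fin 5) t) →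
            v ((![q0, q1, q2] : Fin 3 → Fin 5) t) = v' ((![q0, q1, q2] : Fin 3 → Fin 5) t) → u' t v = u' t v') →
          (∀ t, ∀ v v' : Fin 5 → Fin 5, (∀ j, j ≠ (![p0, p1, p2] : Fin 3 → Fin 5) t →
            j ≠ (![q0, q1, q2] : Fin 3 → Fin 5) t → v j = v' j) → w' t v = w' t v') →
          ¬ ∀ v : Fin 5 → Fin 5, (if Function.Injective v then (1 : ℂ) else 0) =
            (∑ k, α k (v ((![![0, 1, 2], ![0, 0, 1], ![0, 0, 0]] : Fin 3 → Fin 3 → Fin 5) c k)) * W k v) + ∑ t, u' t v * w' t v :=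
  residual_of_configs
    (config_of_cases ![0, 0, 1] ![1, 2, 2]
      (fun α W hW u w hu hw hfull => triangle_case1 α W hW u w hu hw hfull) case2_T)
    (config_of_cases ![0, 0, 3] ![1, 2, 4]
      (fun α W hW u w hu hw hfull => outside_case1 α W hW u w hu hw hfull) case2_O0)

/-- **«At most two slices», conditional on the two CASE-2 statements.**  In the data format of `LaplaceOptimal 5`: if the
triangle and the `(0; 01,02,34)` configuration are refuted whenever the slot-`0` slice vector is a letter indicator, then
every decomposition of total Laplace weight `< 120` has at most two slice terms. [folklore] -/
theorem laplace_five_at_most_two_slices_of_case2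
    (case2_T : ∀ (α : Fin 3 → Fin 5 → ℂ) (W : Fin 3 → (Fin 5 → Fin 5) → ℂ),
      (∀ k, ∀ v v' : Fin 5 → Fin 5, (∀ j, j ≠ (![0, 1, 2] : Fin 3 → Fin 5) k → v j = v' j) → W k v = W k v') →
      ∀ (u w : Fin 3 → (Fin 5 → Fin 5) → ℂ),
      (∀ t, ∀ v v' : Fin 5 → Fin 5, v ((![0, 0, 1] : Fin 3 → Fin 5) t) = v' ((![0, 0, 1] : Fin 3 → Fin 5) t) →
        v ((![1, 2, 2] : Fin 3 → Fin 5) t) = v' ((![1, 2, 2] : Fin 3 → Fin 5) t) → u t v = u t v') →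
      (∀ t, ∀ v v' : Fin 5 → Fin 5, (∀ j, j ≠ (![0, 0, 1] : Fin 3 → Fin 5) t →
        j ≠ (![1, 2, 2] : Fin 3 → Fin 5) t → v j = v' j) → w t v = w t v') →
      (∃ a, α 0 a ≠ 0 ∧ ∀ c, c ≠ a → α 0 c = 0) →
      ¬ ∀ v : Fin 5 → Fin 5, (if Function.Injective v then (1 : ℂ) else 0) =
        (∑ k, α k (v ((![0, 1, 2] : Fin 3 → Fin 5) k)) * W k v) + ∑ t, u t v * w t v)
    (case2_O0 : ∀ (α : Fin 3 → Fin 5 → ℂ) (W : Fin 3 → (Fin 5 → Fin 5) → ℂ),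
      (∀ k, ∀ v v' : Fin 5 → Fin 5, (∀ j, j ≠ (![0, 1, 2] : Fin 3 → Fin 5) k → v j = v' j) → W k v = W k v') →
      ∀ (u w : Fin 3 → (Fin 5 → Fin 5) → ℂ),
      (∀ t, ∀ v v' : Fin 5 → Fin 5, v ((![0, 0, 3] : Fin 3 → Fin 5) t) = v' ((![0, 0, 3] : Fin 3 → Fin 5) t) →
        v ((![1, 2, 4] : Fin 3 → Fin 5) t) = v' ((![1, 2, 4] : Fin 3 → Fin 5) t) → u t v = u t v') →
      (∀ t, ∀ v v' : Fin 5 → Fin 5, (∀ j, j ≠ (![0, 0, 3] : Fin 3 → Fin 5) t →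
        j ≠ (![1, 2, 4] : Fin 3 → Fin 5) t → v j = v' j) → w t v = w t v') →
      (∃ a, α 0 a ≠ 0 ∧ ∀ c, c ≠ a → α 0 c = 0) →
      ¬ ∀ v : Fin 5 → Fin 5, (if Function.Injective v then (1 : ℂ) else 0) =
        (∑ k, α k (v ((![0, 1, 2] : Fin 3 → Fin 5) k)) * W k v) + ∑ t, u t v * w t v)
    {N : ℕ} (T : Finset (Fin N)) (S : Fin N → Finset (Fin 5))
    (u w : Fin N → (Fin 5 → Fin 5) → ℂ)
    (hu : ∀ t, ∀ v v' : Fin 5 → Fin 5, (∀ i ∈ S t, v i = v' i) → u t v = u t v')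
    (hw : ∀ t, ∀ v v' : Fin 5 → Fin 5, (∀ i, i ∉ S t → v i = v' i) → w t v = w t v')
    (hsum : ∀ v : Fin 5 → Fin 5, (∑ t ∈ T, u t v * w t v) = if Function.Injective v then 1 else 0)
    (hlt : ∑ t ∈ T, (S t).card.factorial * (5 - (S t).card).factorial < 120) :
    (T.filter (fun t => (S t).card = 1 ∨ (S t).card = 4)).card ≤ 2 :=
  LaplaceFiveSlices.laplace_five_at_most_two_slices_of_residual (residual_of_case2 case2_T case2_O0)
    T S u w hu hw hsum hlt

end LaplaceResidual

end Summit.ValiantsHypothesis.ValiantsHypothesis.Theorems.RigidityForcesSymmetryRankRigidMinimalRepr
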